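import Literature.MathematicalPhysics.QuantumFieldTheory.Balaban1983to89.B11Ineq189LeafD
import Literature.MathematicalPhysics.QuantumFieldTheory.Balaban1983to89.B11Ineq73HasMajConcrete
import Literature.MathematicalPhysics.QuantumFieldTheory.Balaban1983to89.B11Ineq189

/-!
# `Balaban1983to89.B11Ineq189D2DDecayConcrete` — T. Bałaban, *The variational problem and background fields in renormalization group method for lattice gauge theories*, Commun. Math. Phys. **102** (1985) 277–309 [Balaban1985Variational], p. 308, the author-omitted second differentiation behind (189): THE LOCATED UNPRINTED INTERMEDIATE δ𝔇 = (δ²∕δA′²)D(A′) HAS THE JOINT EXPONENTIAL MAJORANT e^{−¼δ₀d(y,y″)}·e^{−¼δ₀d(y,y′)} AT THE CONCRETE `C_j` — from the printed (73) alone, by Cauchy's estimate on the derivative and the symmetry of second derivatives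

statement-level skeleton of published theorems with citation tags; proofs where landed; nothing here is a claim about the Yang–Mills mass gap

PDF held: `paper:balaban1985-cmp102-variational-background` (journal page = PDF page + 276); (73) p. 289 [PDF 13], Prop. 3 p. 289, (185) and (189)
p. 308 [PDF 32] read by this seat; displays in the render-verified transcriptions of `B11Eq73KernelConcrete` ∕ `B11Ineq73HasMajConcrete` ((73)),
`B11Prop3Concrete` (Prop. 3, (49), (55)), `B11Eq185SecondDerivative` ((185)), `B11Ineq189` ((189)).

CITATION HEADER (lean-in-tree rule 2026-08-18).  WHAT IS REPRODUCED: SKELETON row **B11.Eq189** ((189) p. 308, cell GAPS G-B11-G2 — p. 308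
verbatim: *«Now we have to differentiate those expressions second time. We do not perform these calculations here, we have obtained all necessary
results to do the calculations and estimates, let us formulate a final result only»*), item **U1′** of the cell census (`SECOND-DERIVATIVE-189.md`
§4: *«δ𝔇 has the JOINT majorant size_c(δ𝔇[𝔄]μ) ≦ θ_{δ𝔇}·e^{−⅛δ₀d(c,y″)}·e^{−¼δ₀d(c,y′)}·size_{y″}(μ)·N_{y′}(𝔄) (μ localised at y″, 𝔄 at y′),
θ_{δ𝔇} = O(1)C₂ (no ε)»* — the second functional derivative of the Sect. C map `D` of (47)–(49), *«Not displayed anywhere in B11 or [3]–[6]»*),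
whose SHAPE is kernel-checked in `B11Ineq189.d2D_shape` ∕ `d2D_hasMaj₂` modulo the unprinted formula (U1) `[I + ℜ]δ𝔇 = Ψ₁ − Ψ₂`.  THIS FILE
PROVES THE JOINT MAJORANT FOR THE CONCRETE `D = Dfix (C_j(U₀, ·)) H (C₂(Lʲ)²)` of `B11Prop3Concrete` WITHOUT (U1), from the printed (73) alone.

THE PRINT, verbatim.  (73) p. 289: *«|𝔇(A′; c, b)| ≦ O(1)C₃ε₃(L^jη)^{−d+1}e^{−(1∕2)δ₀d(c₋,y)}, b ∈ B^j(y), y ∈ Λ_j. (73)»* (tree: the `HasMaj`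
letter `B11Ineq73HasMajConcrete.hasMaj_fderiv_Dfix`, fine-bond sup size → coarse-bond sup size of the cube geometry, constant `θ_D`, rate `½δ₀`,
at EVERY `‖A′‖ < ε`).  Prop. 3 p. 289: *«the map (47) is defined and analytic for A′ satisfying (43)»* (tree: `B11Ineq189LeafD.differentiableOn_D_concrete`).
(185) p. 308: *«((δ²∕δA′²)V)(A′)𝔄 = (d∕dτ)((δ∕δA′)V)(A′ + τ𝔄)|_{τ=0} = (1∕2πi)∮_{|τ|=r} (dτ∕τ²)((δ∕δA′)V)(A′ + τ𝔄) (185)»*.  (189) p. 308: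
*«|((δ∕δA′)𝔚)(A′, 𝔄; y, y′)| ≦ O(1)ε₃e^{−¼δ₀d(y,y′)}N_{y′}(𝔄) for A′ satisfying (77)»*.

THE MECHANISM (this file's; print has none).  `δ𝔇(A′)[𝔄]μ = (∂∕∂τ)𝔇(A′ + τ𝔄)μ|_{τ=0}` ((185) with `(δ∕δA′)V ↦ 𝔇`).  For `‖A′‖ < ½ε`, `𝔄` localised in
the block `y′` and `μ` in the block `y″`: (A) along the disc `|τ| ≦ ½ε∕‖𝔄‖` the points `A′ + τ𝔄` stay in the (73)-ball `‖·‖ < ε`, where (73) gives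
`size_y(𝔇(A′ + τ𝔄)μ) ≦ θ_D e^{−½δ₀d(y,y″)} size_{y″}(μ)` UNIFORMLY in `τ`; Cauchy's estimate (`SCV.norm_fderiv_apply_le`, componentwise on the coarse
bonds of `Δ(y)`) gives `size_y(δ𝔇(A′)[𝔄]μ) ≦ (2∕ε)θ_D e^{−½δ₀d(y,y″)} size(μ)·‖𝔄‖`, and `‖𝔄‖ ≦ size_{y′}(𝔄)` for a localised `𝔄`; (B) the second
derivative of the holomorphic `D` is SYMMETRIC (`δ𝔇(A′)[𝔄]μ = δ𝔇(A′)[μ]𝔄`, Mathlib `ContDiffAt.isSymmSndFDerivAt_of_omega`), so the same bound holds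
with the roles of `(𝔄, y′)` and `(μ, y″)` exchanged: `≦ (2∕ε)θ_D e^{−½δ₀d(y,y′)} size(μ) size(𝔄)`; (C) `min{e^{−½δ₀p}, e^{−½δ₀q}} ≦ e^{−¼δ₀p}e^{−¼δ₀q}`
(geometric mean).  Hence THE JOINT MAJORANT `(2∕ε)θ_D·e^{−¼δ₀d(y,y″)}·e^{−¼δ₀d(y,y′)}` — rates `(¼δ₀, ¼δ₀)`, at least the census's `(⅛δ₀, ¼δ₀)`;
and since `θ_D = d·e^{½dδ₀}(1 − q)⁻¹e^{dδ₀}C₃(Lʲ)²·2ε` carries ONE power of `ε` ((73): `𝔇 = O(ε₃)` because `D` is quadratic), the constant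
`(2∕ε)θ_D = 4d·e^{½dδ₀}(1 − q)⁻¹e^{dδ₀}C₃(Lʲ)²` has NO `ε` — the census's «θ_{δ𝔇} = O(1)C₂ (no ε)» (`thetaD2_eq`).

WHAT IS CERTIFIED (kernel, sorry-free; axioms `propext` ∕ `Classical.choice` ∕ `Quot.sound`).
§1 (generic, complex normed `E`, complete `F`): `fderiv_apply_proj` (the derivative of a coarse component is the component of the derivative);
   **`norm_d2_apply_le_of_deriv_bound`** — CAUCHY ON THE DERIVATIVE, componentwise: if `‖(∂_v f)(X + τu)(c)‖ ≦ K` on the circle `|τ| = r` of a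
   disc inside the domain of holomorphy, then `‖(∂_u∂_v f)(X)(c)‖ ≦ K∕r`; **`d2_apply_symm`** — `∂_u∂_v f(X) = ∂_v∂_u f(X)` for `f` holomorphic on
   an open set (holomorphic ⇒ `C^ω` ⇒ symmetric second derivative); `le_geomMean_exp` (step (C)).
§2 `norm_add_smul_lt` (the disc stays in the ball); **`hasMaj₂_d2_Dfix_concrete` — δ𝔇 HAS THE JOINT MAJORANT AT THE CONCRETE `C_j`**: in the
   regime of `B11Ineq73HasMajConcrete.hasMaj_fderiv_Dfix` ((73): `9C₂(Lʲ)²B₀ε < 1`, `3ε < b`, the H-kernel letter `hHker` = [5] Thm 3.12 in kernel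
   form with its smallness `q < 1`) and of `B11Ineq189LeafD.differentiableOn_D_concrete` (Prop. 3: `18C₂(Lʲ)²B₀dc₁ε ≦ 1`, `2ε ≦ b∕2`), for every
   `‖A′‖ < ½ε` and every ℝ-bilinear reading `Φ` of `(𝔄, μ) ↦ ∂_𝔄∂_μ D(A′)` (`hΦ`):
   `HasMaj₂ (supSize fine) (supSize fine) (supSize coarse) Φ ((2∕ε)θ_D · e^{−¼δ₀|y − y″|₁} · e^{−¼δ₀|y − y′|₁})` on the single-scale cube geometry;
   `thetaD2_eq` (the constant is ε-free: `(2∕ε)θ_D = 4d·e^{½dδ₀}(1 − q)⁻¹e^{dδ₀}C₃(Lʲ)²`); `hasMaj₂_d2_Dfix_concrete_census` (the same weakened to the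
   census's rates `(⅛δ₀, ¼δ₀)` of `B11Ineq189.d2D_shape`, by monotonicity of the exponential).

HONEST SCOPE — what is NOT claimed.  (i) This is the located intermediate δ𝔇 of the census, NOT (189): the sixteen-term assembly
(`B11Ineq189Census`), the other leaves and the norm junction are elsewhere; (189) stays the located leaf `Letters.maj189` (G-B11-G2).  (ii) The route
is NOT the census note's formula (U1) (differentiate (66)∕(68) and invert `I + ℜ`): it is Cauchy-on-(73) + symmetry, which yields the same ε-power
and the rates `(¼δ₀, ¼δ₀) ≧ (⅛δ₀, ¼δ₀)`; the price is the domain `‖A′‖ < ½ε` (half the (73)-ball) and the factor `2∕ε` against `θ_D`'s `2ε`.  (iii)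
Hypotheses are EXACTLY the union of those of `hasMaj_fderiv_Dfix` and `differentiableOn_D_concrete` (both regimes are smallness conditions on the
same `ε`; nothing of [4] Props. 4∕5∕7, [5] Thm 3.12 or (14) is derived here — `hHker` stays a letter as in (73)'s file).  (iv) Single scale `Λ_j`,
[5]'s abstract carrier (DIVERGENCE D-pv27.4 inherited); the second derivative is read through a bilinear-map hypothesis `hΦ` (no `def`).  (v) Nothing
of Propositions 4–9, Theorem 1, (B) UV stability or any summit statement is asserted; NOT summit progress.  No `def`, no new named fact;
theorem-only module.  Unit `pub-ymgap-dag-n07-b-g0` (cell `pub-ymgap`, YM-DAG node N07 = [B11], -b₁ FIRST-MISSING-ESTIMATE seat; eleventh file of the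
seat's (189) line).  Imports `B11Ineq189LeafD`, `B11Ineq73HasMajConcrete`, `B11Ineq189` ONLY; modifies nothing there.

v2 (APPEND-ONLY §3, same seat; every v1 declaration byte-identical): THE CENSUS ROWS CONSUME THE CONCRETE δ𝔇 BY NAME —
`hasMaj₂_d2D2_Dfix_concrete` (δ𝔇₂(A′) := δ𝔇(A′) − δ𝔇(0), the census's «δ𝔇₂ = δ𝔇 − Φ⁰», has the joint majorant with the constant doubled:
`B11Ineq189.HasMaj₂.sub` of §2 at `A′` and at `0`) and `term189_d2_Dfix_concrete` (the SHAPE B mechanism `B11Ineq189.term189_of_d2D` at the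
concrete δ𝔇: contracting the μ-slot against a FIXED fine configuration of sup size `≦ M` gives a (189)-term with the printed rate `¼δ₀` and
constant `θ·M·c₀(δ₀,⅛)ᵈ` on the cube geometry — row sum of Lemma 2.1 [3] by `rowSum_cubeGeometry`).
-/

noncomputable section

open scoped BigOperators Topology ContDiff
open NormedSpace Finset Metric Filter Set

namespace Literature.MathematicalPhysics.QuantumFieldTheory.Balaban1983to89.B11Ineq189D2DDecayConcrete

open Literature.MathematicalPhysics.QuantumFieldTheory.Balaban1983to89
open Literature.Analysis.Complex.SCV Literature.Analysis.Complex.HolomorphicBanach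
open B11SectG B11SupSize190 B11Ineq189 B11Ineq73HasMajConcrete

/-! ## §1 Cauchy on the derivative, componentwise; symmetry; the geometric mean -/

section Generic

variable {E : Type*} [NormedAddCommGroup E] [NormedSpace ℂ E] {X₂ : Type} [Fintype X₂] {E₂ : Type}
  [NormedAddCommGroup E₂] [NormedSpace ℂ E₂]

omit [Fintype X₂] in
/-- The derivative of a coarse COMPONENT is the component of the derivative: `∂_u(Y ↦ h(Y)(c))(X) = (∂_u h(X))(c)`. [folklore]
[cite: Balaban1985Variational, (63) p.287] -/
theorem fderiv_apply_proj {h : E → (X₂ → E₂)} {X : E} (hh : DifferentiableAt ℂ h X) (u : E) (c : X₂) :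
    fderiv ℂ (fun Y => h Y c) X u = fderiv ℂ h X u c := by
  have hc := (hasFDerivAt_pi'.1 hh.hasFDerivAt) c
  rw [hc.fderiv]
  rfl

variable [CompleteSpace E₂]

/-- **CAUCHY'S ESTIMATE ON THE DERIVATIVE, componentwise** ((185) read for `𝔇` in place of `(δ∕δA′)V`): if `f` is holomorphic on an open
`U` containing the closed disc `{X + τu : |τ| ≦ r}` and the derivative family satisfies `‖(∂_v f)(X + τu)(c)‖ ≦ K` on the circle `|τ| = r`, then
`‖(∂_u∂_v f)(X)(c)‖ ≦ K∕r` (`Y ↦ ∂_v f(Y)` is holomorphic — directional derivatives of holomorphic maps are holomorphic — and so is its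
component `c`; `SCV.norm_fderiv_apply_le`). [cite: Balaban1985Variational, (185) p.308, (73) p.289] -/
theorem norm_d2_apply_le_of_deriv_bound {f : E → (X₂ → E₂)} {U : Set E} (hf : DifferentiableOn ℂ f U) (hU : IsOpen U)
    {X u v : E} {r K : ℝ} (hr : 0 < r) (hsub : ∀ z ∈ closedBall (0 : ℂ) r, X + z • u ∈ U) (c : X₂)
    (hK : ∀ z ∈ sphere (0 : ℂ) r, ‖fderiv ℂ f (X + z • u) v c‖ ≤ K) :
    ‖fderiv ℂ (fun Y => fderiv ℂ f Y v) X u c‖ ≤ K / r := by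
  have hg : DifferentiableOn ℂ (fun Y => fderiv ℂ f Y v) U := differentiableOn_fderiv_apply hf hU v
  have hgc : DifferentiableOn ℂ (fun Y => fderiv ℂ f Y v c) U := (differentiableOn_pi.1 hg) c
  have hX : X ∈ U := by simpa using hsub 0 (mem_closedBall_self hr.le)
  have key := norm_fderiv_apply_le hgc hU hr hsub hK
  rwa [fderiv_apply_proj ((hg X hX).differentiableAt (hU.mem_nhds hX)) u c] at key

omit [Fintype X₂] [CompleteSpace E₂] in
/-- **SYMMETRY OF THE SECOND DERIVATIVE OF A HOLOMORPHIC MAP**: `∂_u∂_v f(X) = ∂_v∂_u f(X)` for `f` holomorphic on an open set containing `X`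
(holomorphic ⇒ `C^ω`, `HolomorphicBanach.contDiffOn_omega`; `C^ω` ⇒ symmetric second derivative, Mathlib). [folklore]
[cite: Balaban1985Variational, (185) p.308] -/
theorem d2_apply_symm {F : Type*} [NormedAddCommGroup F] [NormedSpace ℂ F] [CompleteSpace F] {f : E → F} {U : Set E}
    (hf : DifferentiableOn ℂ f U) (hU : IsOpen U) {X : E} (hX : X ∈ U) (u v : E) :
    fderiv ℂ (fun Y => fderiv ℂ f Y v) X u = fderiv ℂ (fun Y => fderiv ℂ f Y u) X v := by
  rw [← fderiv_fderiv_apply hf hU hX u v, ← fderiv_fderiv_apply hf hU hX v u]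
  exact ((contDiffOn_omega hf hU (n := ω)).contDiffAt (hU.mem_nhds hX)).isSymmSndFDerivAt_of_omega u v

omit [Fintype X₂] [CompleteSpace E₂] in
/-- **Step (C), the geometric mean**: `a ≦ θe^{−ρp}` and `a ≦ θe^{−ρq}` with `a, θ ≧ 0` give `a ≦ θe^{−(ρ∕2)p}e^{−(ρ∕2)q}`
(`min ≦ √(product)`). [folklore] [cite: Balaban1985Variational, (189) p.308] -/
theorem le_geomMean_exp {a θ ρ p q : ℝ} (ha : 0 ≤ a) (hθ : 0 ≤ θ) (h1 : a ≤ θ * Real.exp (-(ρ * p)))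
    (h2 : a ≤ θ * Real.exp (-(ρ * q))) :
    a ≤ θ * Real.exp (-(ρ / 2 * p)) * Real.exp (-(ρ / 2 * q)) := by
  have hB : 0 ≤ θ * Real.exp (-(ρ / 2 * p)) * Real.exp (-(ρ / 2 * q)) := by positivity
  have hsq : a * a ≤ (θ * Real.exp (-(ρ * p))) * (θ * Real.exp (-(ρ * q))) :=
    mul_le_mul h1 h2 ha (by positivity)
  have e : (θ * Real.exp (-(ρ / 2 * p)) * Real.exp (-(ρ / 2 * q))) * (θ * Real.exp (-(ρ / 2 * p)) * Real.exp (-(ρ / 2 * q)))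
      = (θ * Real.exp (-(ρ * p))) * (θ * Real.exp (-(ρ * q))) := by
    rw [show -(ρ * p) = -(ρ / 2 * p) + -(ρ / 2 * p) by ring, show -(ρ * q) = -(ρ / 2 * q) + -(ρ / 2 * q) by ring,
      Real.exp_add, Real.exp_add]
    ring
  rw [← e] at hsq
  exact (mul_self_le_mul_self_iff ha hB).2 hsq

omit [Fintype X₂] [CompleteSpace E₂] [NormedSpace ℂ E] in
/-- The disc `|τ| ≦ r` with `r·‖u‖ ≦ ½ε` around a centre `‖X‖ < ½ε` stays in the ball `‖·‖ < ε`. [folklore]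
[cite: Balaban1985Variational, (77) p.290, (185) p.308] -/
theorem norm_add_smul_lt [NormedSpace ℂ E] {X u : E} {ε r : ℝ} (hX : ‖X‖ < ε / 2) (hr : r * ‖u‖ ≤ ε / 2) {z : ℂ}
    (hz : z ∈ closedBall (0 : ℂ) r) : ‖X + z • u‖ < ε := by
  rw [mem_closedBall, dist_zero_right] at hz
  calc ‖X + z • u‖ ≤ ‖X‖ + ‖z • u‖ := norm_add_le _ _
    _ = ‖X‖ + ‖z‖ * ‖u‖ := by rw [norm_smul]
    _ ≤ ‖X‖ + r * ‖u‖ := by gcongr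
    _ < ε := by linarith

end Generic

/-! ## §2 δ𝔇 has the joint majorant at the concrete `C_j` -/

section Concrete

open B7Prop1Explicit B7Prop1Local B7Prop2Explicit B7Prop3Flat B7Prop4Flat B7Eq92Concrete B7Prop3GeneralLinear
  B7Prop4GeneralLevels B7Prop5GeneralOperators B7Prop5GeneralInduction B7Prop5GeneralLevels B7Prop5General B7Ineq149Pairing
  B13Contraction113 B11Eq44Concrete B11Prop3Model B11Prop3Concrete B11Ineq189LeafD

variable {d : ℕ} {𝔸 : Type} [NormedRing 𝔸] [NormedAlgebra ℂ 𝔸] [CompleteSpace 𝔸] [NormOneClass 𝔸]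

variable (L : ℕ) (hL : 2 ≤ L) {G : Subgroup 𝔸ˣ} (hG : AvgClosed d L G) (k : ℕ)
  (U₀ : B7Prop1Explicit.Site d → Fin d → 𝔸ˣ) (hU₀ : ∀ x κ, U₀ x κ ∈ G) {α₀ : ℝ} (hα : 0 < α₀)
  (hα3 : C0 d * α₀ ≤ 1 / 3) (hα4 : 4 * α₀ ≤ c2' d L) (h52 : pdev U₀ < α₀ * (((L : ℝ) ^ k)⁻¹) ^ 2)
  {b : ℝ} (hb : 0 < b)
  (hsmall : Real.exp (4 * (800 * ((d : ℝ) + 1) ^ 2 * ((d : ℝ) + 4)) * α₀)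
    * (1 + 8 * (131072 * ((d : ℝ) + 1) ^ 2) * ((L : ℝ) ^ k * b)) ≤ 2)
  (hc₃ : 4 * ((L : ℝ) ^ k * b) < c3 d L)
  (h145 : 8 * d * thetaGen d L α₀ * (L : ℝ)⁻¹ ^ 4 ≤ 1)
  (h155 : (2 * (L : ℝ) - 1) * (L : ℝ)⁻¹ ^ 2 + 2 * d * thetaGen d L α₀ * (L : ℝ)⁻¹ ^ 3
    + 1 / 8 * (1 + 2 * d * thetaGen d L α₀ * (L : ℝ)⁻¹ ^ 2 + 2 * d * C3Gen d L * ((L : ℝ) ^ k * b)) * (L : ℝ)⁻¹ ^ 2 ≤ 1)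
  (S T : Finset (B7Prop1Explicit.Site d × Fin d)) (H : (T → 𝔸) →L[ℂ] (S → 𝔸)) {B₀ B₁ δ₀ ε : ℝ}

include hL hG hU₀ hα hα3 hα4 h52 hb hsmall hc₃ h145 h155 in
/-- **δ𝔇 = (δ²∕δA′²)D(A′) HAS THE JOINT MAJORANT AT THE CONCRETE `C_j`** (the census's located unprinted intermediate U1′, for the selector
`D = Dfix (C_j(U₀, ·)) H (C₂(Lʲ)²)` of Proposition 3): in the union of the regimes of `B11Ineq73HasMajConcrete.hasMaj_fderiv_Dfix` ((73) with
decay: `9C₂(Lʲ)²B₀ε < 1`, `3ε < b`, `hHker`, `q < 1`) and `B11Ineq189LeafD.differentiableOn_D_concrete` (Prop. 3: `1 ≦ d`, `1 ≦ c₁`,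
`18C₂(Lʲ)²B₀dc₁ε ≦ 1`, `2ε ≦ b∕2`), for every `‖A′‖ < ½ε` and every ℝ-bilinear reading `Φ 𝔄 μ = ∂_𝔄∂_μ D(A′)` (`hΦ`):
`size_y(Φ 𝔄 μ) ≦ (2∕ε)θ_D·e^{−¼δ₀|y − y″|₁}·e^{−¼δ₀|y − y′|₁}·size_{y″}(μ)·size_{y′}(𝔄)` for `μ` localised in the cube `y″` and `𝔄` in the cube `y′`
— i.e. `HasMaj₂` between the fine-bond sup sizes (twice) and the coarse-bond sup size of the single-scale cube geometry, with
`θ_D = d·e^{½dδ₀}(1 − q)⁻¹e^{dδ₀}C₃(Lʲ)²·2ε` the (73) constant.  Route: Cauchy on (73) along `A′ + τ𝔄` (radius `½ε∕size(𝔄)`), symmetry of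
`∂²D`, geometric mean (§1). [cite: Balaban1985Variational, (189) p.308, (73) p.289, (185) p.308, Prop. 3 p.289] -/
theorem hasMaj₂_d2_Dfix_concrete {j : ℕ} (hj : j ≤ k) (hd : 1 ≤ d) (hB₀ : 0 ≤ B₀) (hH : ∀ X, ‖H X‖ ≤ B₀ * ‖X‖)
    {c1h : ℝ} (hc1h : 1 ≤ c1h) (hε : 0 < ε)
    (h18 : 18 * ((8 * (131072 * ((d : ℝ) + 1) ^ 2) * Real.exp (4 * (800 * ((d : ℝ) + 1) ^ 2 * ((d : ℝ) + 4)) * α₀)) *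
      ((L : ℝ) ^ j) ^ 2) * B₀ * d * c1h * ε ≤ 1) (h2 : 2 * ε ≤ b / 2)
    (hq9 : 9 * ((8 * (131072 * ((d : ℝ) + 1) ^ 2) * Real.exp (4 * (800 * ((d : ℝ) + 1) ^ 2 * ((d : ℝ) + 4)) * α₀))
      * ((L : ℝ) ^ j) ^ 2) * B₀ * ε < 1) (hε3 : 3 * ε < b)
    (hδ₀ : 0 < δ₀) (hB₁ : 0 ≤ B₁)
    (hHker : ∀ (c'' : T) (Y : 𝔸) (s : S),
      ‖H (Pi.single c'' Y) s‖ ≤ B₁ * Real.exp (-(δ₀ * ((B7Prop1Explicit.l1 (loK L j c''.1.1 - s.1.1) : ℝ) / (L : ℝ) ^ j))) * ‖Y‖)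
    (hq : (C3Gen d L * (((L : ℝ) ^ j) ^ 2 * (2 * ε)) * (2 * d) * B₁ * Real.exp (2 * d * δ₀)) * (d * B6.c0 δ₀ (1 / 2) ^ d) < 1)
    {A' : S → 𝔸} (hA : ‖A'‖ < ε / 2)
    (Φ : (S → 𝔸) →ₗ[ℝ] (S → 𝔸) →ₗ[ℝ] (T → 𝔸))
    (hΦ : ∀ (v μ : S → 𝔸) (c : T), Φ v μ c = fderiv ℂ (fun Y : S → 𝔸 => fderiv ℂ
        (Dfix (Cmap L U₀ S T j) (H : (T → 𝔸) →ₗ[ℂ] (S → 𝔸)) ((8 * (131072 * ((d : ℝ) + 1) ^ 2) *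
          Real.exp (4 * (800 * ((d : ℝ) + 1) ^ 2 * ((d : ℝ) + 4)) * α₀)) * ((L : ℝ) ^ j) ^ 2)) Y μ) A' v c) :
    HasMaj₂ (supSize (cubeGeometry L j S T) (boxS L j S T) (blkS L j S T) : BlockNorm (cubeGeometry L j S T) (S → 𝔸))
      (supSize (cubeGeometry L j S T) (boxS L j S T) (blkS L j S T) : BlockNorm (cubeGeometry L j S T) (S → 𝔸))
      (supSize (cubeGeometry L j S T) (boxT L j S T) (blkT L j S T) : BlockNorm (cubeGeometry L j S T) (T → 𝔸)) Φ
      (fun y y'' y' => 2 / ε * (d * Real.exp (1 / 2 * d * δ₀) *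
          ((1 - (C3Gen d L * (((L : ℝ) ^ j) ^ 2 * (2 * ε)) * (2 * d) * B₁ * Real.exp (2 * d * δ₀)) *
              (d * B6.c0 δ₀ (1 / 2) ^ d))⁻¹ * (Real.exp (d * δ₀) * (C3Gen d L * ((L : ℝ) ^ j) ^ 2 * (2 * ε))))) *
        Real.exp (-(δ₀ / 4 * (cubeGeometry L j S T).dist y y'')) *
        Real.exp (-(δ₀ / 4 * (cubeGeometry L j S T).dist y y'))) := by
  classical
  -- abbreviations
  set D : (S → 𝔸) → (T → 𝔸) := Dfix (Cmap L U₀ S T j) (H : (T → 𝔸) →ₗ[ℂ] (S → 𝔸))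
    ((8 * (131072 * ((d : ℝ) + 1) ^ 2) * Real.exp (4 * (800 * ((d : ℝ) + 1) ^ 2 * ((d : ℝ) + 4)) * α₀)) * ((L : ℝ) ^ j) ^ 2)
    with hD_def
  set θD : ℝ := d * Real.exp (1 / 2 * d * δ₀) *
      ((1 - (C3Gen d L * (((L : ℝ) ^ j) ^ 2 * (2 * ε)) * (2 * d) * B₁ * Real.exp (2 * d * δ₀)) *
          (d * B6.c0 δ₀ (1 / 2) ^ d))⁻¹ * (Real.exp (d * δ₀) * (C3Gen d L * ((L : ℝ) ^ j) ^ 2 * (2 * ε))))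
    with hθD_def
  have hQ1 : 0 < 1 - (C3Gen d L * (((L : ℝ) ^ j) ^ 2 * (2 * ε)) * (2 * d) * B₁ * Real.exp (2 * d * δ₀)) *
      (d * B6.c0 δ₀ (1 / 2) ^ d) := by linarith
  have hC3 : 0 ≤ C3Gen d L := by unfold C3Gen C1ppGen; positivity
  have hθD : 0 ≤ θD := by
    rw [hθD_def]
    exact mul_nonneg (by positivity) (mul_nonneg (inv_nonneg.2 hQ1.le) (by positivity))
  set g := cubeGeometry L j S T with hg_def
  set bS : BlockNorm g (S → 𝔸) := supSize g (boxS L j S T) (blkS L j S T) with hbS_def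
  set bT : BlockNorm g (T → 𝔸) := supSize g (boxT L j S T) (blkT L j S T) with hbT_def
  -- the two tree facts: holomorphy of `D` on the ball (Prop. 3) and the (73) majorant at every point of the ball
  have hH' : ∀ X, ‖(H : (T → 𝔸) →ₗ[ℂ] (S → 𝔸)) X‖ ≤ B₀ * ‖X‖ := fun X => by simpa using hH X
  have hDiff : DifferentiableOn ℂ D (ball (0 : S → 𝔸) ε) :=
    differentiableOn_D_concrete L hL hG k U₀ hU₀ hα hα3 hα4 h52 hb hsmall hc₃ h145 h155 S T
      (H : (T → 𝔸) →ₗ[ℂ] (S → 𝔸)) hj hd hB₀ hH' hc1h hε h18 h2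
  have h73 : ∀ {P : S → 𝔸}, ‖P‖ < ε →
      HasMaj bS bT ((fderiv ℂ D P).restrictScalars ℝ : (S → 𝔸) →ₗ[ℝ] (T → 𝔸))
        (fun y y' => θD * Real.exp (-(δ₀ / 2 * g.dist y y'))) := fun hP =>
    hasMaj_fderiv_Dfix L hL hG k U₀ hU₀ hα hα3 hα4 h52 hb hsmall hc₃ h145 h155 S T H hj hB₀ hH hq9 hε3 hδ₀ hB₁ hHker hq
      hε.le hP
  have hA' : A' ∈ ball (0 : S → 𝔸) ε := by
    rw [mem_ball_zero_iff]; linarith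
  -- the claim
  intro y' 𝔄 h𝔄 y'' μ hμ y
  have hA_le : ‖𝔄‖ ≤ bS.loc y' 𝔄 := norm_le_loc_of_isLoc (blkS L j S T) y' 𝔄 h𝔄
  have hμ_le : ‖μ‖ ≤ bS.loc y'' μ := norm_le_loc_of_isLoc (blkS L j S T) y'' μ hμ
  have hℓA0 : 0 ≤ bS.loc y' 𝔄 := bS.loc_nonneg y' 𝔄
  have hℓμ0 : 0 ≤ bS.loc y'' μ := bS.loc_nonneg y'' μ
  have hK0 : 0 ≤ 2 / ε * θD * Real.exp (-(δ₀ / 4 * g.dist y y'')) * Real.exp (-(δ₀ / 4 * g.dist y y')) := by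
    positivity
  refine loc_le_of_forall (by positivity) fun c hc => ?_
  -- degenerate directions
  by_cases hA0 : bS.loc y' 𝔄 = 0
  · have h𝔄0 : 𝔄 = 0 := norm_le_zero_iff.1 (hA_le.trans hA0.le)
    subst h𝔄0
    rw [LinearMap.map_zero₂, Pi.zero_apply, norm_zero]
    positivity
  by_cases hμ0 : bS.loc y'' μ = 0
  · have hμ00 : μ = 0 := norm_le_zero_iff.1 (hμ_le.trans hμ0.le)
    subst hμ00
    rw [map_zero, Pi.zero_apply, norm_zero]
    positivity
  have hℓA : 0 < bS.loc y' 𝔄 := lt_of_le_of_ne hℓA0 (Ne.symm hA0)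
  have hℓμ : 0 < bS.loc y'' μ := lt_of_le_of_ne hℓμ0 (Ne.symm hμ0)
  -- (A) Cauchy along `A′ + τ𝔄`, radius `½ε / size(𝔄)`, with (73) on the circle: decay in the μ-slot
  have hrA : 0 < ε / 2 / bS.loc y' 𝔄 := by positivity
  have hsubA : ∀ z ∈ closedBall (0 : ℂ) (ε / 2 / bS.loc y' 𝔄), A' + z • 𝔄 ∈ ball (0 : S → 𝔸) ε := fun z hz => by
    rw [mem_ball_zero_iff]
    refine norm_add_smul_lt hA ?_ hz
    calc ε / 2 / bS.loc y' 𝔄 * ‖𝔄‖ ≤ ε / 2 / bS.loc y' 𝔄 * bS.loc y' 𝔄 := by gcongr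
      _ = ε / 2 := by field_simp
  have hbdA : ∀ z ∈ sphere (0 : ℂ) (ε / 2 / bS.loc y' 𝔄),
      ‖fderiv ℂ D (A' + z • 𝔄) μ c‖ ≤ θD * Real.exp (-(δ₀ / 2 * g.dist y y'')) * bS.loc y'' μ := fun z hz => by
    have hP : ‖A' + z • 𝔄‖ < ε := by
      have := hsubA z (sphere_subset_closedBall hz)
      rwa [mem_ball_zero_iff] at this
    have hmaj := h73 hP y'' μ hμ y
    exact (norm_apply_le_loc hc _).trans hmaj
  have hA1 : ‖Φ 𝔄 μ c‖ ≤ θD * Real.exp (-(δ₀ / 2 * g.dist y y'')) * bS.loc y'' μ / (ε / 2 / bS.loc y' 𝔄) := by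
    rw [hΦ]
    exact norm_d2_apply_le_of_deriv_bound hDiff isOpen_ball hrA hsubA c hbdA
  have hA2 : ‖Φ 𝔄 μ c‖ ≤ (2 / ε * θD * bS.loc y'' μ * bS.loc y' 𝔄) * Real.exp (-(δ₀ / 2 * g.dist y y'')) := by
    refine hA1.trans (le_of_eq ?_)
    field_simp
  -- (B) the same with the slots exchanged (symmetry of ∂²D): decay in the 𝔄-slot
  have hrB : 0 < ε / 2 / bS.loc y'' μ := by positivity
  have hsubB : ∀ z ∈ closedBall (0 : ℂ) (ε / 2 / bS.loc y'' μ), A' + z • μ ∈ ball (0 : S → 𝔸) ε := fun z hz => by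
    rw [mem_ball_zero_iff]
    refine norm_add_smul_lt hA ?_ hz
    calc ε / 2 / bS.loc y'' μ * ‖μ‖ ≤ ε / 2 / bS.loc y'' μ * bS.loc y'' μ := by gcongr
      _ = ε / 2 := by field_simp
  have hbdB : ∀ z ∈ sphere (0 : ℂ) (ε / 2 / bS.loc y'' μ),
      ‖fderiv ℂ D (A' + z • μ) 𝔄 c‖ ≤ θD * Real.exp (-(δ₀ / 2 * g.dist y y')) * bS.loc y' 𝔄 := fun z hz => by
    have hP : ‖A' + z • μ‖ < ε := by
      have := hsubB z (sphere_subset_closedBall hz)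
      rwa [mem_ball_zero_iff] at this
    have hmaj := h73 hP y' 𝔄 h𝔄 y
    exact (norm_apply_le_loc hc _).trans hmaj
  have hB1 : ‖Φ 𝔄 μ c‖ ≤ θD * Real.exp (-(δ₀ / 2 * g.dist y y')) * bS.loc y' 𝔄 / (ε / 2 / bS.loc y'' μ) := by
    rw [hΦ, d2_apply_symm hDiff isOpen_ball hA' 𝔄 μ]
    exact norm_d2_apply_le_of_deriv_bound hDiff isOpen_ball hrB hsubB c hbdB
  have hB2 : ‖Φ 𝔄 μ c‖ ≤ (2 / ε * θD * bS.loc y'' μ * bS.loc y' 𝔄) * Real.exp (-(δ₀ / 2 * g.dist y y')) := by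
    refine hB1.trans (le_of_eq ?_)
    field_simp
  -- (C) geometric mean
  have hgm := le_geomMean_exp (ρ := δ₀ / 2) (norm_nonneg _) (by positivity) hA2 hB2
  refine hgm.trans (le_of_eq ?_)
  rw [show δ₀ / 2 / 2 = δ₀ / 4 by ring]
  ring

/-- **THE CONSTANT IS ε-FREE** — (73)'s `θ_D = d·e^{½dδ₀}(1 − q)⁻¹e^{dδ₀}C₃(Lʲ)²·2ε` carries one power of `ε` (`𝔇 = O(ε₃)`: `D` is quadratic), so
`(2∕ε)θ_D = 4d·e^{½dδ₀}(1 − q)⁻¹e^{dδ₀}C₃(Lʲ)²`: the census's «θ_{δ𝔇} = O(1)C₂ (no ε)». [cite: Balaban1985Variational, (189) p.308, (73) p.289] -/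
theorem thetaD2_eq {dR C₃L Q B e1 e2 ε : ℝ} (hε : ε ≠ 0) :
    2 / ε * (dR * e1 * ((1 - Q * B)⁻¹ * (e2 * (C₃L * (2 * ε))))) = 4 * dR * e1 * (1 - Q * B)⁻¹ * e2 * C₃L := by
  field_simp
  ring

include hL hG hU₀ hα hα3 hα4 h52 hb hsmall hc₃ h145 h155 in
/-- **THE SAME AT THE CENSUS'S RATES `(⅛δ₀, ¼δ₀)`** — the hypothesis shape of `B11Ineq189.d2D_shape` ∕ `B11Ineq189Census` for the
δ𝔇-family (μ-slot rate `⅛δ₀`, 𝔄-slot rate `¼δ₀`), by `e^{−¼δ₀d} ≦ e^{−⅛δ₀d}` (distances `≧ 0`). [cite: Balaban1985Variational, (189) p.308, (73) p.289] -/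
theorem hasMaj₂_d2_Dfix_concrete_census {j : ℕ} (hj : j ≤ k) (hd : 1 ≤ d) (hB₀ : 0 ≤ B₀) (hH : ∀ X, ‖H X‖ ≤ B₀ * ‖X‖)
    {c1h : ℝ} (hc1h : 1 ≤ c1h) (hε : 0 < ε)
    (h18 : 18 * ((8 * (131072 * ((d : ℝ) + 1) ^ 2) * Real.exp (4 * (800 * ((d : ℝ) + 1) ^ 2 * ((d : ℝ) + 4)) * α₀)) *
      ((L : ℝ) ^ j) ^ 2) * B₀ * d * c1h * ε ≤ 1) (h2 : 2 * ε ≤ b / 2)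
    (hq9 : 9 * ((8 * (131072 * ((d : ℝ) + 1) ^ 2) * Real.exp (4 * (800 * ((d : ℝ) + 1) ^ 2 * ((d : ℝ) + 4)) * α₀))
      * ((L : ℝ) ^ j) ^ 2) * B₀ * ε < 1) (hε3 : 3 * ε < b)
    (hδ₀ : 0 < δ₀) (hB₁ : 0 ≤ B₁)
    (hHker : ∀ (c'' : T) (Y : 𝔸) (s : S),
      ‖H (Pi.single c'' Y) s‖ ≤ B₁ * Real.exp (-(δ₀ * ((B7Prop1Explicit.l1 (loK L j c''.1.1 - s.1.1) : ℝ) / (L : ℝ) ^ j))) * ‖Y‖)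
    (hq : (C3Gen d L * (((L : ℝ) ^ j) ^ 2 * (2 * ε)) * (2 * d) * B₁ * Real.exp (2 * d * δ₀)) * (d * B6.c0 δ₀ (1 / 2) ^ d) < 1)
    {A' : S → 𝔸} (hA : ‖A'‖ < ε / 2)
    (Φ : (S → 𝔸) →ₗ[ℝ] (S → 𝔸) →ₗ[ℝ] (T → 𝔸))
    (hΦ : ∀ (v μ : S → 𝔸) (c : T), Φ v μ c = fderiv ℂ (fun Y : S → 𝔸 => fderiv ℂ
        (Dfix (Cmap L U₀ S T j) (H : (T → 𝔸) →ₗ[ℂ] (S → 𝔸)) ((8 * (131072 * ((d : ℝ) + 1) ^ 2) *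
          Real.exp (4 * (800 * ((d : ℝ) + 1) ^ 2 * ((d : ℝ) + 4)) * α₀)) * ((L : ℝ) ^ j) ^ 2)) Y μ) A' v c) :
    HasMaj₂ (supSize (cubeGeometry L j S T) (boxS L j S T) (blkS L j S T) : BlockNorm (cubeGeometry L j S T) (S → 𝔸))
      (supSize (cubeGeometry L j S T) (boxS L j S T) (blkS L j S T) : BlockNorm (cubeGeometry L j S T) (S → 𝔸))
      (supSize (cubeGeometry L j S T) (boxT L j S T) (blkT L j S T) : BlockNorm (cubeGeometry L j S T) (T → 𝔸)) Φ
      (fun y y'' y' => 2 / ε * (d * Real.exp (1 / 2 * d * δ₀) *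
          ((1 - (C3Gen d L * (((L : ℝ) ^ j) ^ 2 * (2 * ε)) * (2 * d) * B₁ * Real.exp (2 * d * δ₀)) *
              (d * B6.c0 δ₀ (1 / 2) ^ d))⁻¹ * (Real.exp (d * δ₀) * (C3Gen d L * ((L : ℝ) ^ j) ^ 2 * (2 * ε))))) *
        Real.exp (-(δ₀ / 8 * (cubeGeometry L j S T).dist y y'')) *
        Real.exp (-(δ₀ / 4 * (cubeGeometry L j S T).dist y y'))) := by
  have h := hasMaj₂_d2_Dfix_concrete L hL hG k U₀ hU₀ hα hα3 hα4 h52 hb hsmall hc₃ h145 h155 S T H hj hd hB₀ hH hc1h hε h18 h2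
    hq9 hε3 hδ₀ hB₁ hHker hq hA Φ hΦ
  have hQ1 : 0 < 1 - (C3Gen d L * (((L : ℝ) ^ j) ^ 2 * (2 * ε)) * (2 * d) * B₁ * Real.exp (2 * d * δ₀)) *
      (d * B6.c0 δ₀ (1 / 2) ^ d) := by linarith
  have hC3 : 0 ≤ C3Gen d L := by unfold C3Gen C1ppGen; positivity
  refine h.mono fun y y'' y' => ?_
  have hdist : 0 ≤ (cubeGeometry L j S T).dist y y'' := dist_nonneg_cubeGeometry L j S T y y''
  have hexp : Real.exp (-(δ₀ / 4 * (cubeGeometry L j S T).dist y y'')) ≤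
      Real.exp (-(δ₀ / 8 * (cubeGeometry L j S T).dist y y'')) :=
    Real.exp_le_exp.2 (by nlinarith)
  have h0 : 0 ≤ 2 / ε * (d * Real.exp (1 / 2 * d * δ₀) *
      ((1 - (C3Gen d L * (((L : ℝ) ^ j) ^ 2 * (2 * ε)) * (2 * d) * B₁ * Real.exp (2 * d * δ₀)) *
          (d * B6.c0 δ₀ (1 / 2) ^ d))⁻¹ * (Real.exp (d * δ₀) * (C3Gen d L * ((L : ℝ) ^ j) ^ 2 * (2 * ε))))) :=
    mul_nonneg (by positivity) (mul_nonneg (by positivity) (mul_nonneg (inv_nonneg.2 hQ1.le) (by positivity)))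
  gcongr

/-! ## §3 The census rows consume the concrete δ𝔇 by name: δ𝔇₂ and the SHAPE B contraction -/

include hL hG hU₀ hα hα3 hα4 h52 hb hsmall hc₃ h145 h155 in
/-- **δ𝔇₂ := δ𝔇(A′) − δ𝔇(0) AT THE CONCRETE `C_j`** (the census's «δ𝔇₂ = δ(𝔇₂) = δ𝔇 − Φ⁰», cell note §4 U1 «AT A′ = 0»; `B11Ineq189Census.d2D2_hasMaj₂`
reads Φ⁰ = δ𝔇(0) through a local leaf — here both terms are read through §2, which also holds at `A′ = 0`): for `‖A′‖ < ½ε` and ℝ-bilinear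
readings `Φ`, `Φ₀` of `∂²D(A′)`, `∂²D(0)`, the family `T = Φ − Φ₀` has the joint majorant of §2 at the census's rates with the constant doubled
(`B11Ineq189.HasMaj₂.sub`). [cite: Balaban1985Variational, p.289 (𝔇₂), (189) p.308, (73) p.289] -/
theorem hasMaj₂_d2D2_Dfix_concrete {j : ℕ} (hj : j ≤ k) (hd : 1 ≤ d) (hB₀ : 0 ≤ B₀) (hH : ∀ X, ‖H X‖ ≤ B₀ * ‖X‖)
    {c1h : ℝ} (hc1h : 1 ≤ c1h) (hε : 0 < ε)
    (h18 : 18 * ((8 * (131072 * ((d : ℝ) + 1) ^ 2) * Real.exp (4 * (800 * ((d : ℝ) + 1) ^ 2 * ((d : ℝ) + 4)) * α₀)) *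
      ((L : ℝ) ^ j) ^ 2) * B₀ * d * c1h * ε ≤ 1) (h2 : 2 * ε ≤ b / 2)
    (hq9 : 9 * ((8 * (131072 * ((d : ℝ) + 1) ^ 2) * Real.exp (4 * (800 * ((d : ℝ) + 1) ^ 2 * ((d : ℝ) + 4)) * α₀))
      * ((L : ℝ) ^ j) ^ 2) * B₀ * ε < 1) (hε3 : 3 * ε < b)
    (hδ₀ : 0 < δ₀) (hB₁ : 0 ≤ B₁)
    (hHker : ∀ (c'' : T) (Y : 𝔸) (s : S),
      ‖H (Pi.single c'' Y) s‖ ≤ B₁ * Real.exp (-(δ₀ * ((B7Prop1Explicit.l1 (loK L j c''.1.1 - s.1.1) : ℝ) / (L : ℝ) ^ j))) * ‖Y‖)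
    (hq : (C3Gen d L * (((L : ℝ) ^ j) ^ 2 * (2 * ε)) * (2 * d) * B₁ * Real.exp (2 * d * δ₀)) * (d * B6.c0 δ₀ (1 / 2) ^ d) < 1)
    {A' : S → 𝔸} (hA : ‖A'‖ < ε / 2)
    (Φ Φ₀ T₂ : (S → 𝔸) →ₗ[ℝ] (S → 𝔸) →ₗ[ℝ] (T → 𝔸))
    (hΦ : ∀ (v μ : S → 𝔸) (c : T), Φ v μ c = fderiv ℂ (fun Y : S → 𝔸 => fderiv ℂ
        (Dfix (Cmap L U₀ S T j) (H : (T → 𝔸) →ₗ[ℂ] (S → 𝔸)) ((8 * (131072 * ((d : ℝ) + 1) ^ 2) *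
          Real.exp (4 * (800 * ((d : ℝ) + 1) ^ 2 * ((d : ℝ) + 4)) * α₀)) * ((L : ℝ) ^ j) ^ 2)) Y μ) A' v c)
    (hΦ₀ : ∀ (v μ : S → 𝔸) (c : T), Φ₀ v μ c = fderiv ℂ (fun Y : S → 𝔸 => fderiv ℂ
        (Dfix (Cmap L U₀ S T j) (H : (T → 𝔸) →ₗ[ℂ] (S → 𝔸)) ((8 * (131072 * ((d : ℝ) + 1) ^ 2) *
          Real.exp (4 * (800 * ((d : ℝ) + 1) ^ 2 * ((d : ℝ) + 4)) * α₀)) * ((L : ℝ) ^ j) ^ 2)) Y μ) 0 v c)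
    (hT₂ : ∀ v μ, T₂ v μ = Φ v μ - Φ₀ v μ) :
    HasMaj₂ (supSize (cubeGeometry L j S T) (boxS L j S T) (blkS L j S T) : BlockNorm (cubeGeometry L j S T) (S → 𝔸))
      (supSize (cubeGeometry L j S T) (boxS L j S T) (blkS L j S T) : BlockNorm (cubeGeometry L j S T) (S → 𝔸))
      (supSize (cubeGeometry L j S T) (boxT L j S T) (blkT L j S T) : BlockNorm (cubeGeometry L j S T) (T → 𝔸)) T₂
      (fun y y'' y' => 2 * (2 / ε * (d * Real.exp (1 / 2 * d * δ₀) *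
          ((1 - (C3Gen d L * (((L : ℝ) ^ j) ^ 2 * (2 * ε)) * (2 * d) * B₁ * Real.exp (2 * d * δ₀)) *
              (d * B6.c0 δ₀ (1 / 2) ^ d))⁻¹ * (Real.exp (d * δ₀) * (C3Gen d L * ((L : ℝ) ^ j) ^ 2 * (2 * ε)))))) *
        Real.exp (-(δ₀ / 8 * (cubeGeometry L j S T).dist y y'')) *
        Real.exp (-(δ₀ / 4 * (cubeGeometry L j S T).dist y y'))) := by
  have h0 : ‖(0 : S → 𝔸)‖ < ε / 2 := by rw [norm_zero]; positivity
  have hA1 := hasMaj₂_d2_Dfix_concrete_census L hL hG k U₀ hU₀ hα hα3 hα4 h52 hb hsmall hc₃ h145 h155 S T H hj hd hB₀ hH hc1h hε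
    h18 h2 hq9 hε3 hδ₀ hB₁ hHker hq hA Φ hΦ
  have hA0 := hasMaj₂_d2_Dfix_concrete_census L hL hG k U₀ hU₀ hα hα3 hα4 h52 hb hsmall hc₃ h145 h155 S T H hj hd hB₀ hH hc1h hε
    h18 h2 hq9 hε3 hδ₀ hB₁ hHker hq h0 Φ₀ hΦ₀
  refine ((hA1.sub hA0).congr fun v μ => ?_).mono fun y y'' y' => le_of_eq (by ring)
  rw [LinearMap.sub_apply, LinearMap.sub_apply, hT₂]

include hL hG hU₀ hα hα3 hα4 h52 hb hsmall hc₃ h145 h155 in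
/-- **THE SHAPE B MECHANISM AT THE CONCRETE δ𝔇** (`B11Ineq189.term189_of_d2D` BY NAME: *«a δ𝔇-family contracted against a fixed bounded
configuration X»*, census §5 legend): for `‖A′‖ < ½ε`, an ℝ-bilinear reading `Φ` of `∂²D(A′)` and a FIXED fine configuration `X` of sup size
`≦ M` on every cube, the operator `W𝔄 := Φ 𝔄 X = ∂_𝔄∂_X D(A′)` is a (189)-term between the fine and the coarse sup sizes with the PRINTED RATE
`¼δ₀`: `HasMaj … W ((2∕ε)θ_D·M·c₀(δ₀,⅛)ᵈ · e^{−¼δ₀|y − y′|₁})` (the μ-slot rate `⅛δ₀` spent on the row sum of Lemma 2.1 [3],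
`rowSum_cubeGeometry`; `κ = 1` for sup sizes). [cite: Balaban1985Variational, (189) p.308, (88)–(90) pp.291–292, (73) p.289]
[cite: Balaban1984PropagatorsII, Lemma 2.1 (2.61) p.234] -/
theorem term189_d2_Dfix_concrete {j : ℕ} (hj : j ≤ k) (hd : 1 ≤ d) (hB₀ : 0 ≤ B₀) (hH : ∀ X, ‖H X‖ ≤ B₀ * ‖X‖)
    {c1h : ℝ} (hc1h : 1 ≤ c1h) (hε : 0 < ε)
    (h18 : 18 * ((8 * (131072 * ((d : ℝ) + 1) ^ 2) * Real.exp (4 * (800 * ((d : ℝ) + 1) ^ 2 * ((d : ℝ) + 4)) * α₀)) *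
      ((L : ℝ) ^ j) ^ 2) * B₀ * d * c1h * ε ≤ 1) (h2 : 2 * ε ≤ b / 2)
    (hq9 : 9 * ((8 * (131072 * ((d : ℝ) + 1) ^ 2) * Real.exp (4 * (800 * ((d : ℝ) + 1) ^ 2 * ((d : ℝ) + 4)) * α₀))
      * ((L : ℝ) ^ j) ^ 2) * B₀ * ε < 1) (hε3 : 3 * ε < b)
    (hδ₀ : 0 < δ₀) (hB₁ : 0 ≤ B₁)
    (hHker : ∀ (c'' : T) (Y : 𝔸) (s : S),
      ‖H (Pi.single c'' Y) s‖ ≤ B₁ * Real.exp (-(δ₀ * ((B7Prop1Explicit.l1 (loK L j c''.1.1 - s.1.1) : ℝ) / (L : ℝ) ^ j))) * ‖Y‖)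
    (hq : (C3Gen d L * (((L : ℝ) ^ j) ^ 2 * (2 * ε)) * (2 * d) * B₁ * Real.exp (2 * d * δ₀)) * (d * B6.c0 δ₀ (1 / 2) ^ d) < 1)
    {A' : S → 𝔸} (hA : ‖A'‖ < ε / 2)
    (Φ : (S → 𝔸) →ₗ[ℝ] (S → 𝔸) →ₗ[ℝ] (T → 𝔸))
    (hΦ : ∀ (v μ : S → 𝔸) (c : T), Φ v μ c = fderiv ℂ (fun Y : S → 𝔸 => fderiv ℂ
        (Dfix (Cmap L U₀ S T j) (H : (T → 𝔸) →ₗ[ℂ] (S → 𝔸)) ((8 * (131072 * ((d : ℝ) + 1) ^ 2) *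
          Real.exp (4 * (800 * ((d : ℝ) + 1) ^ 2 * ((d : ℝ) + 4)) * α₀)) * ((L : ℝ) ^ j) ^ 2)) Y μ) A' v c)
    {X : S → 𝔸} {M : ℝ} (hM : 0 ≤ M)
    (hX : ∀ y'', (supSize (cubeGeometry L j S T) (boxS L j S T) (blkS L j S T) : BlockNorm (cubeGeometry L j S T) (S → 𝔸)).loc y'' X ≤ M)
    (W : (S → 𝔸) →ₗ[ℝ] (T → 𝔸)) (hW : ∀ v, W v = Φ v X) :
    HasMaj (supSize (cubeGeometry L j S T) (boxS L j S T) (blkS L j S T) : BlockNorm (cubeGeometry L j S T) (S → 𝔸))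
      (supSize (cubeGeometry L j S T) (boxT L j S T) (blkT L j S T) : BlockNorm (cubeGeometry L j S T) (T → 𝔸)) W
      (fun y y' => 1 * (2 / ε * (d * Real.exp (1 / 2 * d * δ₀) *
          ((1 - (C3Gen d L * (((L : ℝ) ^ j) ^ 2 * (2 * ε)) * (2 * d) * B₁ * Real.exp (2 * d * δ₀)) *
              (d * B6.c0 δ₀ (1 / 2) ^ d))⁻¹ * (Real.exp (d * δ₀) * (C3Gen d L * ((L : ℝ) ^ j) ^ 2 * (2 * ε)))))) *
        M * (B6.c0 δ₀ (1 / 8) ^ d) * Real.exp (-(δ₀ / 4 * (cubeGeometry L j S T).dist y y'))) := by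
  have h := hasMaj₂_d2_Dfix_concrete_census L hL hG k U₀ hU₀ hα hα3 hα4 h52 hb hsmall hc₃ h145 h155 S T H hj hd hB₀ hH hc1h hε
    h18 h2 hq9 hε3 hδ₀ hB₁ hHker hq hA Φ hΦ
  have hQ1 : 0 < 1 - (C3Gen d L * (((L : ℝ) ^ j) ^ 2 * (2 * ε)) * (2 * d) * B₁ * Real.exp (2 * d * δ₀)) *
      (d * B6.c0 δ₀ (1 / 2) ^ d) := by linarith
  have hC3 : 0 ≤ C3Gen d L := by unfold C3Gen C1ppGen; positivity
  have hθ : 0 ≤ 2 / ε * (d * Real.exp (1 / 2 * d * δ₀) *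
      ((1 - (C3Gen d L * (((L : ℝ) ^ j) ^ 2 * (2 * ε)) * (2 * d) * B₁ * Real.exp (2 * d * δ₀)) *
          (d * B6.c0 δ₀ (1 / 2) ^ d))⁻¹ * (Real.exp (d * δ₀) * (C3Gen d L * ((L : ℝ) ^ j) ^ 2 * (2 * ε))))) :=
    mul_nonneg (by positivity) (mul_nonneg (by positivity) (mul_nonneg (inv_nonneg.2 hQ1.le) (by positivity)))
  have hrow : RowSum (cubeGeometry L j S T) (δ₀ / 8) (B6.c0 δ₀ (1 / 8) ^ d) := by
    have h8 : δ₀ / 8 = 1 / 8 * δ₀ := by ring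
    rw [h8]
    exact rowSum_cubeGeometry L j S T (by positivity)
  have key := term189_of_d2D (dist_nonneg_cubeGeometry L j S T) hrow hθ hM h hX hW
  simpa only [supSize_κ] using key

end Concrete

end Literature.MathematicalPhysics.QuantumFieldTheory.Balaban1983to89.B11Ineq189D2DDecayConcrete
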